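import Literature.Probability.RandomPlanarGeometry.HexSAWBrickWallStripFugacityLevel0
import Literature.Probability.RandomPlanarGeometry.HexSAWBrickWallStripLocality
import HarnessLib

/-!
# The printed surface-weighted strip growth rate `μ_T(y,1)` on the desorbed side: `μ(S_T) ≤ μ_{T+1}(y,1)`,
# `μ_T(y,1) ≤ μ(S_T)` for `y ≤ 1`, hence `μ_T(y,1) → μ_ℍ` WITH THE RATE `|log μ_ℍ − log μ_{T+1}(y,1)| ≤ 30/√T`
# uniformly in `0 < y ≤ 1`

Topic `Literature/Probability/RandomPlanarGeometry` (continues `HexSAWBrickWallStripFugacityLevel0.lean` — the PRINTED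
one-level surface weight of Beaton–Bousquet-Mélou–de Gier–Duminil-Copin–Guttmann: `HexBW.bottomVisits₀` (bottom row AND odd
abscissa = Duminil-Copin–Smirnov level `0`), `HexBW.stripZ₀ T n y = C_{T,n}(y,1)`, `HexBW.stripMuY₀ T y = μ_T(y,1)`,
`tendsto_stripZ₀_rpow` — and the tree's `HexSAWBrickWallStripLocality.lean`: `μ(S_T) → μ_ℍ` with the explicit rate
`μ_ℍ e^{−30/√T} ≤ μ(S_T) ≤ μ_ℍ` (`HexBW.mul_exp_neg_le_stripConnectiveConstant`)).

Source: N. R. Beaton, M. Bousquet-Mélou, J. de Gier, H. Duminil-Copin, A. J. Guttmann, *The critical fugacity for surface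
adsorption of self-avoiding walks on the honeycomb lattice is `1 + √2`*, Comm. Math. Phys. 326 (2014), arXiv:1109.0358v5, §3.2,
Proposition 7 (p. 11): "For `y > 0`, we have `μ_T(1,y) < μ_{T+1}(1,y)`. Moreover, as `T → ∞`, `μ_T(1,y) → μ(y)`", with
Proposition 6 (p. 10: `μ_T(y,1) = μ_T(1,y)`) and Proposition 5 (p. 9: `μ(y) = μ` for `y ≤ y_c`, `y_c ≥ 1`).  THIS file
proves the convergence clause on the DESORBED SIDE `0 < y ≤ 1` for the printed weight `μ_T(y,1)` (where the printed limit
`μ(y)` is `μ_ℍ`), by COMPARISON with `y = 1` — not by the printed route (unfolding to the half-plane constant) — and WITH THE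
TREE'S RATE: for `T ≥ 1` and `0 < y ≤ 1`, `μ_ℍ e^{−30/√T} ≤ μ(S_T) ≤ μ_{T+1}(y,1) ≤ μ(S_{T+1}) ≤ μ_ℍ`.  Mechanism of the lower
comparison: the walks of `S_T` lifted by the even vector `(1 − 2a₀, 1)` are walks of `S_{T+1}` with NO vertex on the bottom row,
hence of weight `y⁰ = 1` (Madras–Slade §8.2 (8.2.1), p. 267, translation classes).  The row-weighted VARIANT twin of these
statements (for the tree's `HexBW.stripMuY`) is the lane's `HexSAWBrickWallStripFugacityLocality`; the one-level weight is
the printed one (erratum of identification, 2026-08-23).  Label (lane «pcv-sawmu»): CONSOLIDATION of Proposition 7's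
convergence clause on the desorbed side by a different (comparison) proof, with the tree's explicit rate `30/√T` (not in print).

## Statements (namespace `Literature.Probability.RandomPlanarGeometry.SAW.HexBW`, all PROVED)

* `stripZ₀_le_stripCount` (`0 ≤ y ≤ 1`: `C_{T,n}(y,1) ≤ c_n(S_T)`), **`stripMuY₀_le_stripConnectiveConstant`** (`μ_T(y,1) ≤ μ(S_T)`);
* `liftRow`, `liftRow_mem`, `bottomVisits₀_liftRow`, `liftRow_injective`, **`stripCount_le_stripZ₀_succ`** (`c_n(S_T) ≤ C_{T+1,n}(y,1)`,
  every `y > 0`), **`stripConnectiveConstant_le_stripMuY₀_succ`** (`μ(S_T) ≤ μ_{T+1}(y,1)`);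
* **`mul_exp_neg_le_stripMuY₀_succ`** — `μ_ℍ e^{−30/√T} ≤ μ_{T+1}(y,1)` (`T ≥ 1`, every `y > 0`);
* **`abs_log_sub_log_stripMuY₀_le`** — `|log μ_ℍ − log μ_{T+1}(y,1)| ≤ 30/√T` for `T ≥ 1`, `0 < y ≤ 1`;
* **`tendsto_stripMuY₀_of_le_one`** — `μ_T(y,1) → μ_ℍ` as `T → ∞`, for `0 < y ≤ 1`.
-/

noncomputable section

open Filter Topology Finset Literature.Probability.LatticeModels Literature.Probability.Percolation

namespace Literature.Probability.RandomPlanarGeometry.SAW.HexBW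

/-! ### Comparison with `y = 1` from above (`y ≤ 1`) -/

/-- `C_{T,n}(y,1) ≤ c_n(S_T)` for `0 ≤ y ≤ 1` (each weight `y^{i₀} ≤ 1`).
[cite: BeatonBousquetMelouDeGierDuminilCopinGuttmann2014, §3.2 Proposition 6 (arXiv v5 p. 10: non-decreasing in y)] -/
theorem stripZ₀_le_stripCount (T n : ℕ) {y : ℝ} (hy0 : 0 ≤ y) (hy1 : y ≤ 1) : stripZ₀ T n y ≤ stripCount T n := by
  have h : (stripCount T n : ℝ) = ∑ _p ∈ stripPairs T n, (1 : ℝ) := by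
    rw [Finset.sum_const, nsmul_eq_mul, mul_one]; rfl
  rw [h]
  unfold stripZ₀
  exact Finset.sum_le_sum fun p _ => pow_le_one₀ hy0 hy1

/-- **`μ_T(y,1) ≤ μ(S_T)` for `0 < y ≤ 1`.** [cite: BeatonBousquetMelouDeGierDuminilCopinGuttmann2014, §3.2 Proposition 6 (arXiv v5 p. 10) with Proposition 7 (p. 11)] -/
theorem stripMuY₀_le_stripConnectiveConstant (T : ℕ) {y : ℝ} (hy0 : 0 < y) (hy1 : y ≤ 1) :
    stripMuY₀ T y ≤ stripConnectiveConstant T :=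
  le_of_tendsto_of_tendsto' (tendsto_stripZ₀_rpow T hy0) (tendsto_stripCount_rpow T) fun n =>
    Real.rpow_le_rpow (stripZ₀_pos T n hy0).le (stripZ₀_le_stripCount T n hy0.le hy1) (by positivity)

/-! ### Comparison from below: the walks of `S_T` lifted one row into `S_{T+1}` touch no level-`0` vertex -/

/-- The lift vector of a starting site `a`: `(1 − 2a₀, 1)` — one row up, one column sideways (parity preserved, start again in
the cross-section). [cite: MadrasSlade1993, §8.2, eq. (8.2.1) (p. 267)] -/
def liftRowShift (a : Site 2) : Site 2 := fun i => if i = 0 then 1 - 2 * a 0 else 1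

/-- Coordinate `0` of the lift vector. [cite: MadrasSlade1993, §8.2, eq. (8.2.1) (p. 267)] -/
@[simp] theorem liftRowShift_apply_zero (a : Site 2) : liftRowShift a 0 = 1 - 2 * a 0 := if_pos rfl

/-- Coordinate `1` of the lift vector. [cite: MadrasSlade1993, §8.2, eq. (8.2.1) (p. 267)] -/
@[simp] theorem liftRowShift_apply_one (a : Site 2) : liftRowShift a 1 = 1 := if_neg (by decide)

/-- The lift vector has even coordinate sum. [cite: EntingJensen2009, §7.4.2, Fig. 7.10 (brickwork form of the honeycomb lattice)] -/
theorem liftRowShift_even (a : Site 2) : (liftRowShift a 0 + liftRowShift a 1) % 2 = 0 := by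
  rw [liftRowShift_apply_zero, liftRowShift_apply_one]; omega

/-- The lift of a translation class `(a, υ)`. [cite: MadrasSlade1993, §8.2, eq. (8.2.1) (p. 267)] -/
def liftRow (p : Site 2 × (ℕ → Site 2)) : Site 2 × (ℕ → Site 2) := (liftRowShift p.1 + p.1, p.2)

/-- The lift of a walk of `S_T` is a walk of `S_{T+1}`. [cite: MadrasSlade1993, §8.2 (p. 267)] -/
theorem liftRow_mem {T n : ℕ} {p : Site 2 × (ℕ → Site 2)} (hp : p ∈ stripPairs T n) :
    liftRow p ∈ stripPairs (T + 1) n := by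
  obtain ⟨a, υ⟩ := p
  rw [mem_stripPairs] at hp ⊢
  dsimp only at hp
  obtain ⟨ha, hυ, hbw, hR⟩ := hp
  rw [mem_stripStarts] at ha
  obtain ⟨⟨ha0, ha0'⟩, ha1, ha1'⟩ := ha
  refine ⟨?_, hυ, fun i hi => ?_, fun m hm => ?_⟩
  · show liftRowShift a + a ∈ stripStarts (T + 1)
    rw [mem_stripStarts]
    refine ⟨⟨?_, ?_⟩, ?_, ?_⟩ <;>
      simp only [Pi.add_apply, liftRowShift_apply_zero, liftRowShift_apply_one, Nat.cast_add, Nat.cast_one] <;> omega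
  · show brickWallGraph.Adj (liftRowShift a + a + υ i) (liftRowShift a + a + υ (i + 1))
    rw [add_assoc, add_assoc, adj_add_left_iff_of_even (liftRowShift_even a)]
    exact hbw i hi
  · show InStrip (T + 1) (liftRowShift a + a + υ m)
    have h := hR m hm
    simp only [InStrip, Pi.add_apply, liftRowShift_apply_one, Nat.cast_add, Nat.cast_one] at h ⊢
    omega

/-- A lifted walk has no vertex on the bottom row, hence no level-`0` vertex. [cite: BeatonBousquetMelouDeGierDuminilCopinGuttmann2014, §3.2 (arXiv v5 p. 11: the walks avoiding the surface)] -/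
theorem bottomVisits₀_liftRow {T n : ℕ} {p : Site 2 × (ℕ → Site 2)} (hp : p ∈ stripPairs T n) :
    bottomVisits₀ (liftRow p).1 (liftRow p).2 n = 0 := by
  obtain ⟨a, υ⟩ := p
  rw [mem_stripPairs] at hp
  dsimp only at hp
  obtain ⟨-, -, -, hR⟩ := hp
  show bottomVisits₀ (liftRowShift a + a) υ n = 0
  unfold bottomVisits₀
  refine Finset.sum_eq_zero fun m hm => ?_
  rw [Finset.mem_range] at hm
  have h := (hR m (by omega)).1
  simp only [Pi.add_apply, liftRowShift_apply_one] at h ⊢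
  rw [if_neg]
  omega

/-- The lift is injective. [cite: MadrasSlade1993, §8.2 (p. 267)] -/
theorem liftRow_injective : Function.Injective liftRow := by
  rintro ⟨a, υ⟩ ⟨a', υ'⟩ h
  simp only [liftRow, Prod.mk.injEq] at h
  obtain ⟨h1, rfl⟩ := h
  have h0 := congrFun h1 0
  have h1' := congrFun h1 1
  simp only [Pi.add_apply, liftRowShift_apply_zero, liftRowShift_apply_one] at h0 h1'
  have e0 : a 0 = a' 0 := by omega
  have e1 : a 1 = a' 1 := by omega
  have : a = a' := by
    funext i; fin_cases i
    · exact e0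
    · exact e1
  rw [this]

/-- **`c_n(S_T) ≤ C_{T+1,n}(y,1)`** for every `y > 0`: the lifted walks have weight `y⁰ = 1`.
[cite: BeatonBousquetMelouDeGierDuminilCopinGuttmann2014, §3.2 Proposition 7 (arXiv v5 p. 11)] -/
theorem stripCount_le_stripZ₀_succ (T n : ℕ) {y : ℝ} (hy : 0 < y) : (stripCount T n : ℝ) ≤ stripZ₀ (T + 1) n y := by
  classical
  have hsub : (stripPairs T n).image liftRow ⊆ stripPairs (T + 1) n := by
    intro q hq
    obtain ⟨p, hp, rfl⟩ := Finset.mem_image.1 hq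
    exact liftRow_mem hp
  calc (stripCount T n : ℝ) = ∑ _q ∈ (stripPairs T n).image liftRow, (1 : ℝ) := by
        rw [Finset.sum_const, nsmul_eq_mul, mul_one, Finset.card_image_of_injective _ liftRow_injective]
        rfl
    _ = ∑ q ∈ (stripPairs T n).image liftRow, y ^ bottomVisits₀ q.1 q.2 n := by
        refine Finset.sum_congr rfl fun q hq => ?_
        obtain ⟨p, hp, rfl⟩ := Finset.mem_image.1 hq
        rw [bottomVisits₀_liftRow hp, pow_zero]
    _ ≤ stripZ₀ (T + 1) n y := by
        unfold stripZ₀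
        exact Finset.sum_le_sum_of_subset_of_nonneg hsub fun _ _ _ => pow_nonneg hy.le _

/-- **`μ(S_T) ≤ μ_{T+1}(y,1)` for every `y > 0`.** [cite: BeatonBousquetMelouDeGierDuminilCopinGuttmann2014, §3.2 Proposition 7 (arXiv v5 p. 11)] -/
theorem stripConnectiveConstant_le_stripMuY₀_succ (T : ℕ) {y : ℝ} (hy : 0 < y) :
    stripConnectiveConstant T ≤ stripMuY₀ (T + 1) y :=
  le_of_tendsto_of_tendsto' (tendsto_stripCount_rpow T) (tendsto_stripZ₀_rpow (T + 1) hy) fun n =>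
    Real.rpow_le_rpow (Nat.cast_nonneg _) (stripCount_le_stripZ₀_succ T n hy) (by positivity)

/-! ### The rate and the limit on the desorbed side -/

/-- **`μ_ℍ e^{−30/√T} ≤ μ_{T+1}(y,1)`** for `T ≥ 1` and every `y > 0` (the tree's strip locality rate).
[cite: MadrasSlade1993, §8.2, Theorem 8.2.1 (8.2.12) (p. 269); BeatonBousquetMelouDeGierDuminilCopinGuttmann2014, §3.2 Proposition 7 (arXiv v5 p. 11)] -/
theorem mul_exp_neg_le_stripMuY₀_succ {T : ℕ} (hT : 1 ≤ T) {y : ℝ} (hy : 0 < y) :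
    hexConnectiveConstant * Real.exp (-(30 / Real.sqrt T)) ≤ stripMuY₀ (T + 1) y :=
  (mul_exp_neg_le_stripConnectiveConstant hT).1.trans (stripConnectiveConstant_le_stripMuY₀_succ T hy)

/-- `μ_{T+1}(y,1) ≤ μ_ℍ` for `0 < y ≤ 1`. [cite: BeatonBousquetMelouDeGierDuminilCopinGuttmann2014, §3.2 Propositions 6–7 (arXiv v5 pp. 10–11)] -/
theorem stripMuY₀_le_hexConnectiveConstant (T : ℕ) {y : ℝ} (hy0 : 0 < y) (hy1 : y ≤ 1) :
    stripMuY₀ T y ≤ hexConnectiveConstant :=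
  (stripMuY₀_le_stripConnectiveConstant T hy0 hy1).trans (stripConnectiveConstant_le T)

/-- **The locality rate for the PRINTED surface weight, uniformly on the desorbed side**: for `T ≥ 1` and `0 < y ≤ 1`,
`|log μ_ℍ − log μ_{T+1}(y,1)| ≤ 30/√T`. [cite: BeatonBousquetMelouDeGierDuminilCopinGuttmann2014, §3.2 Proposition 7 (arXiv v5 p. 11: "as T → ∞, μ_T(1,y) → μ(y)"); MadrasSlade1993, §8.2, Theorem 8.2.1 (8.2.12) (p. 269)] -/
theorem abs_log_sub_log_stripMuY₀_le {T : ℕ} (hT : 1 ≤ T) {y : ℝ} (hy0 : 0 < y) (hy1 : y ≤ 1) :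
    |Real.log hexConnectiveConstant - Real.log (stripMuY₀ (T + 1) y)| ≤ 30 / Real.sqrt T := by
  have hμ : 0 < hexConnectiveConstant := hexConnectiveConstant_pos
  have hm : 0 < stripMuY₀ (T + 1) y := stripMuY₀_pos (T + 1) hy0
  have hlo := mul_exp_neg_le_stripMuY₀_succ hT hy0
  have hhi := stripMuY₀_le_hexConnectiveConstant (T + 1) hy0 hy1
  have h1 : Real.log hexConnectiveConstant + -(30 / Real.sqrt T) ≤ Real.log (stripMuY₀ (T + 1) y) := by
    have := Real.log_le_log (by positivity) hlo
    rwa [Real.log_mul hμ.ne' (Real.exp_pos _).ne', Real.log_exp] at this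
  have h2 : Real.log (stripMuY₀ (T + 1) y) ≤ Real.log hexConnectiveConstant := Real.log_le_log hm hhi
  have h0 : (0 : ℝ) ≤ 30 / Real.sqrt T := by positivity
  rw [abs_le]
  constructor <;> linarith

/-- **`μ_T(y,1) → μ_ℍ` as `T → ∞`, for `0 < y ≤ 1`** (the printed `μ(y) = μ` on the desorbed side).
[cite: BeatonBousquetMelouDeGierDuminilCopinGuttmann2014, §3.2 Proposition 7 (arXiv v5 p. 11: "as T → ∞, μ_T(1,y) → μ(y)") with Proposition 5 (p. 9: μ(y) = μ for y ≤ y_c)] -/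
theorem tendsto_stripMuY₀_of_le_one {y : ℝ} (hy0 : 0 < y) (hy1 : y ≤ 1) :
    Tendsto (fun T : ℕ => stripMuY₀ T y) atTop (𝓝 hexConnectiveConstant) := by
  have hlow : Tendsto (fun T : ℕ => stripConnectiveConstant (T - 1)) atTop (𝓝 hexConnectiveConstant) :=
    tendsto_stripConnectiveConstant.comp (tendsto_sub_atTop_nat 1)
  refine tendsto_of_tendsto_of_tendsto_of_le_of_le' hlow tendsto_const_nhds ?_
    (Eventually.of_forall fun T => stripMuY₀_le_hexConnectiveConstant T hy0 hy1)
  filter_upwards [eventually_ge_atTop 1] with T hT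
  have h := stripConnectiveConstant_le_stripMuY₀_succ (T - 1) hy0
  rwa [Nat.sub_add_cancel hT] at h

end Literature.Probability.RandomPlanarGeometry.SAW.HexBW
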